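import Literature.Analysis.ValidatedNumerics.TaylorModelPartial
import Literature.Analysis.ValidatedNumerics.TaylorModelSymmDiff
import HarnessLib

/-!
# Edge-panel tools: `∫_{-h}^{τρ} K q` for an exact `q`, and weighted moment sums against moving moments

Trunk T-ANA (Analysis/ValidatedNumerics); namespace `Literature.Analysis.ValidatedNumerics.PolyMP`.  Sequel of
`TaylorModelPartial.lean` / `TaylorModelSymmDiff.lean` for the ONE y-panel adjacent to the window edge, where the
archimedean integrals start or end inside t-panel `0`:
* `partPolyI` / `tmem_partPoly` — `ρ ↦ ∫_{-h}^{τρ} K(u) q(u) du` for a panel kernel `K` (model `W`, reference `pw`) and an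
  EXACT rational polynomial `q` (the moving partial moments `∫_0^{h∓ρ} G t^j dt` of the regularised density);
* `wmomTM` / `tmem_wmom` — if `G(t)·F(ρ,t) = Σ_p Σ_b ρ^p a_{p+b} C(p+b,p) κ_b · (G(t) t^{b−1})` (fixed coefficients
  `a ∈ A`, integer weights `κ_b`, e.g. the divided second/first differences of `TaylorModelSymmDiff`) and `N_j` are Taylor
  models of the moving moments `ρ ↦ ∫_0^{L(ρ)} G t^j dt`, then `ρ ↦ ∫_0^{L(ρ)} G(t) F(ρ,t) dt` is enclosed by
  `Σ_b (row_b · N_{b−1})` (truncated products).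
Integer interval arithmetic plus small exact rationals.  Problem-independent; no facts, no axioms.

## References

* K. Makino, M. Berz, Int. J. Pure Appl. Math. 4 (2003) 379–456, §6. [folklore]
-/

open MeasureTheory intervalIntegral Set Finset

namespace Literature.Analysis.ValidatedNumerics

namespace PolyMP

open Literature.Analysis.ValidatedNumerics.NumericsMP
open Literature.Analysis.ValidatedNumerics.ExpPoly (Poly)
open Literature.Analysis.ValidatedNumerics.ExpPoly

/-! ## `∫_{-h}^{τρ} K(u) q(u) du` for an exact polynomial `q` -/

/-- The Taylor model: exact polynomial `∫_{-h}^{τρ} pw·q` widened by `2h · tabsI(W − pw) · ‖q‖_h`. [folklore] -/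
def partPolyI (S : ℕ) (h : ℚ) (W : IPoly) (pw q : Poly) (τ : ℤ) : IPoly :=
  widen0 (ratPolyI S (partConstPoly h (Poly.mul pw q) τ))
    ⌈2 * h * (tabsI S h (tsubI W (ratPolyI S pw)) : ℚ) * absBoundQ q h⌉

/-- **Soundness of `partPolyI`.** [folklore] -/
theorem tmem_partPoly {S : ℕ} (hS : 0 < S) {h : ℚ} (h0 : 0 ≤ h) {K : ℝ → ℝ}
    (hK : IntervalIntegrable K volume (-(h : ℝ)) h) {W : IPoly} (hW : TMem S h K W) (pw q : Poly) {τ : ℤ}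
    (hτ : τ = 1 ∨ τ = -1) :
    TMem S h (fun ρ => ∫ u in (-(h : ℝ))..((τ : ℝ) * ρ), K u * Poly.eval q u) (partPolyI S h W pw q τ) := by
  intro ρ hρ
  have hhr : (0 : ℝ) ≤ h := by exact_mod_cast h0
  have hSr : (0 : ℝ) < S := by exact_mod_cast hS
  have hρ1 := (abs_le.1 hρ).1
  have hρ2 := (abs_le.1 hρ).2
  have hv1 : -(h : ℝ) ≤ τ * ρ := by rcases hτ with h1 | h1 <;> simp [h1] <;> linarith
  have hv2 : (τ : ℝ) * ρ ≤ h := by rcases hτ with h1 | h1 <;> simp [h1] <;> linarith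
  have hKsub : IntervalIntegrable K volume (-(h : ℝ)) (τ * ρ) :=
    hK.mono_set (by rw [uIcc_of_le hv1, uIcc_of_le (hv1.trans hv2)]; exact Icc_subset_Icc le_rfl hv2)
  have hqc : Continuous fun u => Poly.eval q u := Poly.continuous_eval q
  have hPi : IntervalIntegrable (fun u => Poly.eval (Poly.mul pw q) u) volume (-(h : ℝ)) (τ * ρ) :=
    (Poly.continuous_eval _).intervalIntegrable _ _
  have hKq : IntervalIntegrable (fun u => K u * Poly.eval q u) volume (-(h : ℝ)) (τ * ρ) :=
    hKsub.mul_continuousOn hqc.continuousOn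
  have hsplit : ∫ u in (-(h : ℝ))..((τ : ℝ) * ρ), K u * Poly.eval q u =
      (∫ u in (-(h : ℝ))..((τ : ℝ) * ρ), Poly.eval (Poly.mul pw q) u) +
        ∫ u in (-(h : ℝ))..((τ : ℝ) * ρ), (K u - Poly.eval pw u) * Poly.eval q u := by
    rw [← intervalIntegral.integral_add hPi (by
      have : (fun u => (K u - Poly.eval pw u) * Poly.eval q u) = fun u => K u * Poly.eval q u - Poly.eval (Poly.mul pw q) u := by
        funext u; rw [Poly.eval_mul]; ring
      rw [this]; exact hKq.sub hPi)]
    exact intervalIntegral.integral_congr fun u _ => by rw [Poly.eval_mul]; ring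
  set δ : ℤ := tabsI S h (tsubI W (ratPolyI S pw)) with hδ
  have herr : |∫ u in (-(h : ℝ))..((τ : ℝ) * ρ), (K u - Poly.eval pw u) * Poly.eval q u| * S ≤
      ((⌈2 * h * (δ : ℚ) * absBoundQ q h⌉ : ℤ) : ℝ) := by
    have hb : ∀ u ∈ Set.uIoc (-(h : ℝ)) (τ * ρ), ‖(K u - Poly.eval pw u) * Poly.eval q u‖ ≤
        (δ : ℝ) / S * (absBoundQ q h : ℝ) := by
      intro u hu
      rw [uIoc_of_le hv1] at hu
      have hu' : |u| ≤ h := abs_le.2 ⟨hu.1.le, hu.2.trans hv2⟩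
      rw [Real.norm_eq_abs, abs_mul]
      exact mul_le_mul (abs_sub_poly_le_of_tmem hS h0 hW pw hu') (abs_eval_le_absBoundQ q hu') (abs_nonneg _)
        ((abs_nonneg _).trans (abs_sub_poly_le_of_tmem hS h0 hW pw hu'))
    have h1 := intervalIntegral.norm_integral_le_of_norm_le_const hb
    rw [Real.norm_eq_abs] at h1
    have hlen : |(τ : ℝ) * ρ - -(h : ℝ)| ≤ 2 * h := by rw [abs_le]; constructor <;> linarith
    have hδ0 : 0 ≤ (δ : ℝ) / S :=
      (abs_nonneg _).trans (abs_sub_poly_le_of_tmem hS h0 hW pw (ρ := 0) (by rw [abs_zero]; exact hhr))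
    have hA0 : 0 ≤ (absBoundQ q h : ℝ) := (abs_nonneg _).trans (abs_eval_le_absBoundQ q (y := 0) (by rw [abs_zero]; exact hhr))
    have h2 : |∫ u in (-(h : ℝ))..((τ : ℝ) * ρ), (K u - Poly.eval pw u) * Poly.eval q u| * S ≤ 2 * h * δ * absBoundQ q h := by
      have := mul_le_mul_of_nonneg_right (h1.trans (mul_le_mul_of_nonneg_left hlen (mul_nonneg hδ0 hA0))) hSr.le
      refine this.trans (le_of_eq ?_)
      field_simp
    refine h2.trans ?_
    have hc := (Rat.cast_le (K := ℝ)).2 (Int.le_ceil (2 * h * (δ : ℚ) * absBoundQ q h))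
    push_cast at hc ⊢
    exact hc
  obtain ⟨as, has, e⟩ := tmem_ratPoly S h (partConstPoly h (Poly.mul pw q) τ) ρ hρ
  obtain ⟨bs, hbs, eb⟩ := exists_widen0 has herr ρ
  refine ⟨bs, hbs, ?_⟩
  beta_reduce
  rw [hsplit, eb, ← e]
  beta_reduce
  rw [eval_partConstPoly]

/-! ## Weighted moment sums against moving moments -/

/-- Row `b`: coefficients `p ↦ A_{p+b} · (κ_b C(p+b, p))`, `p < |A| − b`. [folklore] -/
def wrowI (A : IPoly) (κ : ℤ) (b : ℕ) : IPoly :=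
  (List.range (A.length - b)).map fun p => MI.mulInt (A.getD (p + b) default) (κ * ((p + b).choose p : ℕ))

/-- `Σ_{1 ≤ b < |A|} row_b · N_{b−1}` (products truncated at degree `D` on `|ρ| ≤ h`). [folklore] -/
def wmomTM (S : ℕ) (h : ℚ) (D : ℕ) (A : IPoly) (κ : ℕ → ℤ) (N : ℕ → IPoly) : IPoly :=
  (List.range A.length).foldl (fun acc b => if 1 ≤ b then taddI acc (tmulI S h D (wrowI A (κ b) b) (N (b - 1))) else acc) []

/-- Transport of a Taylor model along a pointwise identity on the panel. [folklore] -/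
theorem tmem_congr_on {S : ℕ} {h : ℚ} {f f' : ℝ → ℝ} {P : IPoly} (hf : TMem S h f P)
    (hff' : ∀ ρ : ℝ, |ρ| ≤ h → f ρ = f' ρ) : TMem S h f' P := fun ρ hρ => by
  obtain ⟨as, has, e⟩ := hf ρ hρ
  exact ⟨as, has, by rw [← hff' ρ hρ, e]⟩

/-- The zero model. [folklore] -/
theorem tmem_zero' (S : ℕ) (h : ℚ) : TMem S h (fun _ : ℝ => (0 : ℝ)) [] := fun _ _ => ⟨[], pmem_nil S, rfl⟩

/-- Folded sums of Taylor models over `range N` with a side condition. [folklore] -/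
theorem tmem_foldl_range {S : ℕ} {h : ℚ} {F : ℕ → ℝ → ℝ} {P : ℕ → IPoly} (p : ℕ → Prop) [DecidablePred p]
    {f0 : ℝ → ℝ} {P0 : IPoly} (h0 : TMem S h f0 P0) :
    ∀ N : ℕ, (∀ i, i < N → p i → TMem S h (F i) (P i)) →
      TMem S h (fun ρ => f0 ρ + ∑ i ∈ (Finset.range N).filter p, F i ρ)
        ((List.range N).foldl (fun acc i => if p i then taddI acc (P i) else acc) P0)
  | 0, _ => by simpa using h0
  | N + 1, hF => by
      rw [List.range_succ, List.foldl_append, List.foldl_cons, List.foldl_nil]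
      have ih := tmem_foldl_range p h0 N fun i hi hp => hF i (by omega) hp
      by_cases hN : p N
      · rw [if_pos hN]
        refine tmem_congr_on (tmem_add ih (hF N (by omega) hN)) fun ρ _ => ?_
        rw [Finset.range_add_one, Finset.filter_insert, if_pos hN, Finset.sum_insert (by simp)]
        ring
      · rw [if_neg hN]
        refine tmem_congr_on ih fun ρ _ => ?_
        rw [Finset.range_add_one, Finset.filter_insert, if_neg hN]

/-- The row polynomial as an exact Taylor model of `ρ ↦ Σ_p a_{p+b} κ C(p+b,p) ρ^p`. [folklore] -/
theorem tmem_wrow {S : ℕ} (h : ℚ) {as : List ℝ} {A : IPoly} (has : PMem S as A) (κ : ℤ) (b : ℕ) :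
    TMem S h (fun ρ => ∑ p ∈ range (A.length - b), as.getD (p + b) 0 * ((κ : ℝ) * ((p + b).choose p : ℝ)) * ρ ^ p)
      (wrowI A κ b) := by
  intro ρ _
  refine ⟨(List.range (A.length - b)).map fun p => as.getD (p + b) 0 * ((κ : ℝ) * ((p + b).choose p : ℝ)), ?_, ?_⟩
  · unfold wrowI
    have : ∀ l : List ℕ, (∀ p ∈ l, p + b < A.length) →
        PMem S (l.map fun p => as.getD (p + b) 0 * ((κ : ℝ) * ((p + b).choose p : ℝ)))
          (l.map fun p => MI.mulInt (A.getD (p + b) default) (κ * ((p + b).choose p : ℕ))) := by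
      intro l hl
      induction l with
      | nil => exact pmem_nil S
      | cons p l ih =>
          simp only [List.map_cons]
          refine pmem_cons ?_ (ih fun x hx => hl x (by simp [hx]))
          have := MI.mem_mulInt (mem_getD_of_pmem has (hl p (by simp))) (κ * ((p + b).choose p : ℕ))
          push_cast at this
          exact this
    exact this _ fun p hp => by have := List.mem_range.1 hp; omega
  · rw [evalR_map_range]

/-- **Weighted moment sums.**  If on `|ρ| ≤ h`, `∫_0^{L ρ} G(t) F(ρ,t) dt = Σ_{p<n} Σ_{b<n−p} ρ^p a_{p+b} C(p+b,p) κ_b m_{b−1}(ρ)`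
with `a ∈ A` fixed (`n = |A|`, terms with `b = 0` absent: `κ_0 = 0`) and `N_j` encloses `ρ ↦ m_j(ρ)` for `j + 1 < n`, then
`wmomTM` encloses the integral. [folklore] -/
theorem tmem_wmom {S : ℕ} (hS : 0 < S) {h : ℚ} (h0 : 0 ≤ h) (D : ℕ) {as : List ℝ} {A : IPoly} (has : PMem S as A)
    {κ : ℕ → ℤ} (hκ0 : κ 0 = 0) {mom : ℕ → ℝ → ℝ} {N : ℕ → IPoly}
    (hN : ∀ j, j + 1 < A.length → TMem S h (mom j) (N j)) {I : ℝ → ℝ}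
    (hI : ∀ ρ : ℝ, |ρ| ≤ h → I ρ = ∑ p ∈ range A.length, ∑ b ∈ range (A.length - p),
      ρ ^ p * (as.getD (p + b) 0 * ((p + b).choose p : ℝ)) * ((κ b : ℝ) * mom (b - 1) ρ)) :
    TMem S h I (wmomTM S h D A κ N) := by
  set n := A.length with hn
  -- reorganise the double sum by `b`
  have hre : ∀ ρ : ℝ, ∑ p ∈ range n, ∑ b ∈ range (n - p),
      ρ ^ p * (as.getD (p + b) 0 * ((p + b).choose p : ℝ)) * ((κ b : ℝ) * mom (b - 1) ρ) =
      0 + ∑ b ∈ (range n).filter (fun b => 1 ≤ b),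
        (∑ p ∈ range (n - b), as.getD (p + b) 0 * ((κ b : ℝ) * ((p + b).choose p : ℝ)) * ρ ^ p) * mom (b - 1) ρ := by
    intro ρ
    rw [zero_add]
    -- swap the triangle: `Σ_{p<n} Σ_{b<n−p} = Σ_{b<n} Σ_{p<n−b}`
    have swap : ∑ p ∈ range n, ∑ b ∈ range (n - p),
        ρ ^ p * (as.getD (p + b) 0 * ((p + b).choose p : ℝ)) * ((κ b : ℝ) * mom (b - 1) ρ) =
        ∑ b ∈ range n, ∑ p ∈ range (n - b),
          ρ ^ p * (as.getD (p + b) 0 * ((p + b).choose p : ℝ)) * ((κ b : ℝ) * mom (b - 1) ρ) := by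
      rw [Finset.sum_sigma', Finset.sum_sigma']
      refine Finset.sum_nbij' (fun x => ⟨x.2, x.1⟩) (fun x => ⟨x.2, x.1⟩) ?_ ?_ (fun _ _ => rfl) (fun _ _ => rfl)
        (fun _ _ => rfl)
      · intro x hx
        simp only [Finset.mem_sigma, Finset.mem_range] at hx ⊢
        omega
      · intro x hx
        simp only [Finset.mem_sigma, Finset.mem_range] at hx ⊢
        omega
    rw [swap, Finset.sum_filter]
    refine Finset.sum_congr rfl fun b hb => ?_
    by_cases hb1 : 1 ≤ b
    · rw [if_pos hb1, Finset.sum_mul]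
      refine Finset.sum_congr rfl fun p _ => ?_
      ring
    · rw [if_neg hb1]
      have : b = 0 := by omega
      subst this
      simp [hκ0]
  have hrows : ∀ b, b < n → 1 ≤ b → TMem S h
      (fun ρ => (∑ p ∈ range (n - b), as.getD (p + b) 0 * ((κ b : ℝ) * ((p + b).choose p : ℝ)) * ρ ^ p) * mom (b - 1) ρ)
      (tmulI S h D (wrowI A (κ b) b) (N (b - 1))) := fun b hb hb1 =>
    tmem_mul hS h0 D (hn ▸ tmem_wrow h has (κ b) b) (hN (b - 1) (by omega))
  have := tmem_foldl_range (fun b => 1 ≤ b) (tmem_zero' S h) n hrows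
  refine tmem_congr_on this fun ρ hρ => ?_
  rw [hI ρ hρ, hre ρ]

/-! ## Chunked weighted moment sums (kernel budget) -/

/-- The rows `b₀ ≤ b < b₀ + n` of the weighted moment sum, rows truncated at degree `D` before the products. [folklore] -/
def wmomRangeTM (S : ℕ) (h : ℚ) (D : ℕ) (A : IPoly) (κ : ℕ → ℤ) (N : ℕ → IPoly) (b0 n : ℕ) : IPoly :=
  (List.range n).foldl (fun acc j =>
    taddI acc (tmulI S h D (ttruncI S h D (wrowI A (κ (b0 + j)) (b0 + j))) (N (b0 + j - 1)))) []

/-- One row `Σ_p a_{p+b} κ_b C(p+b,p) ρ^p` (real side of `wrowI`). [folklore] -/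
noncomputable def wrowR (as : List ℝ) (n : ℕ) (κ : ℕ → ℤ) (b : ℕ) (ρ : ℝ) : ℝ :=
  ∑ p ∈ range (n - b), as.getD (p + b) 0 * ((κ b : ℝ) * ((p + b).choose p : ℝ)) * ρ ^ p

/-- **Soundness of a chunk**: `wmomRangeTM … b₀ n` encloses `ρ ↦ Σ_{j<n} row_{b₀+j}(ρ) m_{b₀+j−1}(ρ)`. [folklore] -/
theorem tmem_wmomRange {S : ℕ} (hS : 0 < S) {h : ℚ} (h0 : 0 ≤ h) (D : ℕ) {as : List ℝ} {A : IPoly} (has : PMem S as A)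
    (κ : ℕ → ℤ) {mom : ℕ → ℝ → ℝ} {N : ℕ → IPoly} (b0 : ℕ) :
    ∀ n : ℕ, (∀ j, j < n → TMem S h (mom (b0 + j - 1)) (N (b0 + j - 1))) →
      TMem S h (fun ρ => ∑ j ∈ range n, wrowR as A.length κ (b0 + j) ρ * mom (b0 + j - 1) ρ)
        (wmomRangeTM S h D A κ N b0 n)
  | 0, _ => by simpa [wmomRangeTM] using tmem_zero' S h
  | n + 1, hN => by
      have ih := tmem_wmomRange hS h0 D has κ b0 n fun j hj => hN j (by omega)
      unfold wmomRangeTM at ih ⊢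
      rw [List.range_succ, List.foldl_append, List.foldl_cons, List.foldl_nil]
      have hrow := tmem_mul hS h0 D (tmem_trunc h0 D (tmem_wrow h has (κ (b0 + n)) (b0 + n))) (hN n (by omega))
      refine tmem_congr_on (tmem_add ih hrow) fun ρ _ => ?_
      rw [Finset.sum_range_succ]
      rfl

/-- Crude bound of the rows `b ≥ b₁`: `Σ_{j < |A| − b₁} ‖row_{b₁+j}‖_h · M̄_{b₁+j−1}` (`0 ≤ m_j(ρ) ≤ M̄_j/S`). [folklore] -/
def wmomTailQ (S : ℕ) (h : ℚ) (A : IPoly) (κ : ℕ → ℤ) (Mhi : ℕ → ℤ) (b1 : ℕ) : ℚ :=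
  ∑ j ∈ Finset.range (A.length - b1),
    (tabsI S h (wrowI A (κ (b1 + j)) (b1 + j)) : ℚ) / S * ((Mhi (b1 + j - 1) : ℚ) / S)

/-- **The crude tail bound.** For `|ρ| ≤ h` and `0 ≤ m_j(ρ) ≤ M̄_j/S`:
`|Σ_{j < |A| − b₁} row_{b₁+j}(ρ) m_{b₁+j−1}(ρ)| ≤ wmomTailQ`. [folklore] -/
theorem abs_wrowTail_le {S : ℕ} (hS : 0 < S) {h : ℚ} (h0 : 0 ≤ h) {as : List ℝ} {A : IPoly} (has : PMem S as A)
    (κ : ℕ → ℤ) {mom : ℕ → ℝ → ℝ} {Mhi : ℕ → ℤ} {b1 : ℕ} (hb1 : 1 ≤ b1) {ρ : ℝ} (hρ : |ρ| ≤ h)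
    (hmom : ∀ j, j + 1 < A.length → 0 ≤ mom j ρ ∧ mom j ρ ≤ (Mhi j : ℝ) / S) :
    |∑ j ∈ range (A.length - b1), wrowR as A.length κ (b1 + j) ρ * mom (b1 + j - 1) ρ| ≤
      (wmomTailQ S h A κ Mhi b1 : ℝ) := by
  unfold wmomTailQ
  have hSr : (0 : ℝ) < S := by exact_mod_cast hS
  push_cast
  refine (Finset.abs_sum_le_sum_abs _ _).trans (Finset.sum_le_sum fun j hj => ?_)
  have hj' := Finset.mem_range.1 hj
  rw [abs_mul]
  have hrow : |wrowR as A.length κ (b1 + j) ρ| ≤ (tabsI S h (wrowI A (κ (b1 + j)) (b1 + j)) : ℝ) / S := by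
    rw [le_div_iff₀ hSr]
    exact abs_le_tabsI h0 (tmem_wrow h has (κ (b1 + j)) (b1 + j)) hρ
  obtain ⟨hm0, hm1⟩ := hmom (b1 + j - 1) (by omega)
  rw [abs_of_nonneg hm0]
  exact mul_le_mul hrow hm1 hm0 ((abs_nonneg _).trans hrow)

/-- The double sum of `TaylorModelSymmDiff` reorganised by rows. [folklore] -/
theorem wsum_eq_rows (as : List ℝ) {κ : ℕ → ℤ} (hκ0 : κ 0 = 0) (mom : ℕ → ℝ → ℝ) (ρ : ℝ) :
    ∑ p ∈ range as.length, ∑ b ∈ range (as.length - p),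
      ρ ^ p * (as.getD (p + b) 0 * ((p + b).choose p : ℝ)) * ((κ b : ℝ) * mom (b - 1) ρ) =
      ∑ j ∈ range (as.length - 1), wrowR as as.length κ (1 + j) ρ * mom (1 + j - 1) ρ := by
  set n := as.length with hn
  have swap : ∑ p ∈ range n, ∑ b ∈ range (n - p),
      ρ ^ p * (as.getD (p + b) 0 * ((p + b).choose p : ℝ)) * ((κ b : ℝ) * mom (b - 1) ρ) =
      ∑ b ∈ range n, ∑ p ∈ range (n - b),
        ρ ^ p * (as.getD (p + b) 0 * ((p + b).choose p : ℝ)) * ((κ b : ℝ) * mom (b - 1) ρ) := by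
    rw [Finset.sum_sigma', Finset.sum_sigma']
    refine Finset.sum_nbij' (fun x => ⟨x.2, x.1⟩) (fun x => ⟨x.2, x.1⟩) ?_ ?_ (fun _ _ => rfl) (fun _ _ => rfl)
      (fun _ _ => rfl)
    · intro x hx
      simp only [Finset.mem_sigma, Finset.mem_range] at hx ⊢
      omega
    · intro x hx
      simp only [Finset.mem_sigma, Finset.mem_range] at hx ⊢
      omega
  rw [swap]
  -- drop `b = 0` and shift
  rcases Nat.eq_zero_or_pos n with hn0 | hnpos
  · rw [hn0]; simp
  · obtain ⟨n', hn'⟩ : ∃ n', n = n' + 1 := ⟨n - 1, by omega⟩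
    rw [hn', Finset.sum_range_succ', show n' + 1 - 1 = n' by omega]
    simp only [hκ0, Int.cast_zero, zero_mul, mul_zero, Finset.sum_const_zero, add_zero]
    refine Finset.sum_congr rfl fun j _ => ?_
    rw [wrowR, show 1 + j = j + 1 by ring, show j + 1 - 1 = j by omega, Finset.sum_mul]
    refine Finset.sum_congr rfl fun p _ => ?_
    ring

/-- **Chunked weighted moment sum**: two chunks `[1, 1+n₁)`, `[1+n₁, 1+n₁+n₂)` and the crude tail from `b₁ = 1+n₁+n₂`.
[folklore] -/
theorem tmem_wmom_chunks {S : ℕ} (hS : 0 < S) {h : ℚ} (h0 : 0 ≤ h) {as : List ℝ} {A : IPoly} (has : PMem S as A)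
    {κ : ℕ → ℤ} (hκ0 : κ 0 = 0) {mom : ℕ → ℝ → ℝ} {n1 n2 : ℕ} (hn : 1 + n1 + n2 ≤ A.length) {P1 P2 : IPoly}
    (hP1 : TMem S h (fun ρ => ∑ j ∈ range n1, wrowR as A.length κ (1 + j) ρ * mom (1 + j - 1) ρ) P1)
    (hP2 : TMem S h (fun ρ => ∑ j ∈ range n2, wrowR as A.length κ (1 + n1 + j) ρ * mom (1 + n1 + j - 1) ρ) P2)
    {Mhi : ℕ → ℤ} (hmom : ∀ ρ : ℝ, |ρ| ≤ h → ∀ j, j + 1 < A.length → 0 ≤ mom j ρ ∧ mom j ρ ≤ (Mhi j : ℝ) / S)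
    {I : ℝ → ℝ}
    (hI : ∀ ρ : ℝ, |ρ| ≤ h → I ρ = ∑ p ∈ range A.length, ∑ b ∈ range (A.length - p),
      ρ ^ p * (as.getD (p + b) 0 * ((p + b).choose p : ℝ)) * ((κ b : ℝ) * mom (b - 1) ρ)) :
    TMem S h I (widen0 (taddI P1 P2) ⌈wmomTailQ S h A κ Mhi (1 + n1 + n2) * S⌉) := by
  intro ρ hρ
  have hSr : (0 : ℝ) < S := by exact_mod_cast hS
  have hlen : as.length = A.length := has.length_eq
  obtain ⟨cs, hcs, e12⟩ := tmem_add hP1 hP2 ρ hρ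
  -- split the row sum at `n1`, `n1 + n2`
  have hsplit : I ρ = (∑ j ∈ range n1, wrowR as A.length κ (1 + j) ρ * mom (1 + j - 1) ρ) +
      (∑ j ∈ range n2, wrowR as A.length κ (1 + n1 + j) ρ * mom (1 + n1 + j - 1) ρ) +
      ∑ j ∈ range (A.length - (1 + n1 + n2)), wrowR as A.length κ (1 + n1 + n2 + j) ρ * mom (1 + n1 + n2 + j - 1) ρ := by
    rw [hI ρ hρ, ← hlen, wsum_eq_rows as hκ0 mom ρ, hlen]
    have e : A.length - 1 = n1 + (n2 + (A.length - (1 + n1 + n2))) := by omega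
    rw [e, Finset.sum_range_add, Finset.sum_range_add, ← add_assoc]
    congr 1
    · congr 1
      refine Finset.sum_congr rfl fun j _ => ?_
      rw [show 1 + (n1 + j) = 1 + n1 + j by ring]
    · refine Finset.sum_congr rfl fun j _ => ?_
      rw [show 1 + (n1 + (n2 + j)) = 1 + n1 + n2 + j by ring]
  have htail := abs_wrowTail_le hS h0 has κ (b1 := 1 + n1 + n2) (by omega) hρ (hmom ρ hρ)
  have herr : |I ρ - ((∑ j ∈ range n1, wrowR as A.length κ (1 + j) ρ * mom (1 + j - 1) ρ) +
      (∑ j ∈ range n2, wrowR as A.length κ (1 + n1 + j) ρ * mom (1 + n1 + j - 1) ρ))| * S ≤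
      ((⌈wmomTailQ S h A κ Mhi (1 + n1 + n2) * S⌉ : ℤ) : ℝ) := by
    rw [hsplit, add_sub_cancel_left]
    have h1 := mul_le_mul_of_nonneg_right htail hSr.le
    refine h1.trans ?_
    have hc := (Rat.cast_le (K := ℝ)).2 (Int.le_ceil (wmomTailQ S h A κ Mhi (1 + n1 + n2) * S))
    push_cast at hc ⊢
    exact hc
  obtain ⟨bs, hbs, eb⟩ := exists_widen0 hcs herr ρ
  refine ⟨bs, hbs, ?_⟩
  rw [eb, ← e12]
  ring

end PolyMP

end Literature.Analysis.ValidatedNumerics
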